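import Summits.BirchSwinnertonDyer.BirchSwinnertonDyer.Theorems.ResidualThetaTransportAtTwoThetaLayerLambdaCongruenceAtTwoCurveMuPropagation
import HarnessLib

/-!
# Crux `MazurTateCongruenceAtTwoTop` (stmt-BirchSwinnertonDyer-25797 = 21416), line `symbol`: the plus-line bridge WITHOUT the
# analytic-rank hypotheses — (PAR2) for EVERY partner `A` (any analytic rank) from (C3⁺) + trace congruence + `μ⁎(W)`, `μ⁎(A)`
# (lead prover bsd-wall-tp2-p1 g10; `--supports 25797`; closes nothing)

HONEST FRAMING. THEOREMS ONLY; (C3⁺) / the six named facts, the trace congruence and the two `μ`-hypotheses are explicit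
hypotheses; nothing about their truth is asserted; BSD is not proved by any of this.

WHAT. `…ROfPlusLine.depletedParity_of_congruent_of_plusLine` asked `W.analyticRank = 0` and `A.analyticRank = 0` ONLY to obtain
primitive `2`-adic scalings of the two depleted plus-symbol tables (`exists_primitive_scaling_depletedCurveSymbol`, whose
non-vanishing input is `L(•,1) ≠ 0`). Under the hypotheses `μ⁎(W)`, `μ⁎(A)` that the same theorem already carries (the doubled
Néron table `2ϖ_•Ψ_•` takes a unit value at a point of maximal `‖Ψ_•‖`) the scalings `2ϖ`, `2ϖ_A` ARE primitive
(`primitive_scaling_of_mu`, §0), so both rank hypotheses are idle: `depletedParity_of_congruent_of_plusLine_anyRank` and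
`depletedParity_of_congruent_of_facts_anyRank` are the same theorems with `hr`, `hrA` deleted and the proof otherwise verbatim.
Consequence (files `…ROfPlusLineListAnyRank`, `…RAssembly`): the crux's conclusion for EVERY partner of the habitat, and the crux
BY NAME from named hypotheses.

References: [GreenbergVatsal2000] Thm. (1.4), §3 (13); [Vatsal1999] (1.6), Thm. (1.13); [PollackWeston2011MT] §3.1.
-/

set_option linter.dupNamespace false
set_option autoImplicit false

noncomputable section

open scoped Classical MatrixGroups Polynomial

open CongruenceSubgroup Literature.NumberTheory.EllipticCurves Literature.NumberTheory.EllipticCurves.ModularForms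
  Summit.BirchSwinnertonDyer.BirchSwinnertonDyer.Theorems.ThetaLayerLambdaCongruenceAtTwo

namespace Summit.BirchSwinnertonDyer.BirchSwinnertonDyer.Theorems.MazurTateCongruenceAtTwoR

/-! ## §0. `μ⁎` supplies the primitive scaling (no analytic-rank input) -/

section Scaling

variable (W : WeierstrassCurve ℚ) {N : ℕ} (f : CuspForm (Gamma0 N) 2)
  (S₀ : Finset (IsDedekindDomain.HeightOneSpectrum (NumberField.RingOfIntegers ℚ))) (ϖ : ℚ)

/-- Under `μ⁎` (the doubled expanded depleted table `2ϖΨ` takes a unit value at a point `x₀` of maximal `‖Ψ‖`), `c = 2ϖ` is a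
primitive scaling of `Ψ`: `‖cΨ(x)‖ ≤ 1` everywhere and `= 1` at `x₀` — the output shape of
`exists_primitive_scaling_depletedCurveSymbol`, with no `L(W,1) ≠ 0`. [cite: GreenbergVatsal2000, §1 p. 9 (display (8))] -/
theorem primitive_scaling_of_mu
    (hμ : ∃ x₀ : ℚ, (∀ r : ℚ, ‖(∑ k ∈ Fintype.piFinset (fun _ : S₀ ↦ Finset.range 3), (∏ v : S₀, ((W.localPolynomialAt (v : IsDedekindDomain.HeightOneSpectrum (NumberField.RingOfIntegers ℚ))).map (Int.castRingHom (PadicAlgCl 2))).coeff (k v) * ((Rat.HeightOneSpectrum.natGenerator (v : IsDedekindDomain.HeightOneSpectrum (NumberField.RingOfIntegers ℚ)) : PadicAlgCl 2)⁻¹) ^ (k v)) * algebraMap ℚ (PadicAlgCl 2) (ratPlusSymbol f (r * ((∏ v : S₀, Rat.HeightOneSpectrum.natGenerator (v : IsDedekindDomain.HeightOneSpectrum (NumberField.RingOfIntegers ℚ)) ^ (k v) : ℕ) : ℚ))))‖ ≤ ‖(∑ k ∈ Fintype.piFinset (fun _ : S₀ ↦ Finset.range 3), (∏ v : S₀, ((W.localPolynomialAt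 (v : IsDedekindDomain.HeightOneSpectrum (NumberField.RingOfIntegers ℚ))).map (Int.castRingHom (PadicAlgCl 2))).coeff (k v) * ((Rat.HeightOneSpectrum.natGenerator (v : IsDedekindDomain.HeightOneSpectrum (NumberField.RingOfIntegers ℚ)) : PadicAlgCl 2)⁻¹) ^ (k v)) * algebraMap ℚ (PadicAlgCl 2) (ratPlusSymbol f (x₀ * ((∏ v : S₀, Rat.HeightOneSpectrum.natGenerator (v : IsDedekindDomain.HeightOneSpectrum (NumberField.RingOfIntegers ℚ)) ^ (k v) : ℕ) : ℚ))))‖) ∧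
      ‖algebraMap ℚ (PadicAlgCl 2) (2 * ϖ) * (∑ k ∈ Fintype.piFinset (fun _ : S₀ ↦ Finset.range 3), (∏ v : S₀, ((W.localPolynomialAt (v : IsDedekindDomain.HeightOneSpectrum (NumberField.RingOfIntegers ℚ))).map (Int.castRingHom (PadicAlgCl 2))).coeff (k v) * ((Rat.HeightOneSpectrum.natGenerator (v : IsDedekindDomain.HeightOneSpectrum (NumberField.RingOfIntegers ℚ)) : PadicAlgCl 2)⁻¹) ^ (k v)) * algebraMap ℚ (PadicAlgCl 2) (ratPlusSymbol f (x₀ * ((∏ v : S₀, Rat.HeightOneSpectrum.natGenerator (v : IsDedekindDomain.HeightOneSpectrum (NumberField.RingOfIntegers ℚ)) ^ (k v) : ℕ) : ℚ))))‖ = 1) :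
    ∃ c : PadicAlgCl 2, (∀ x : ℚ, ‖c * (∑ k ∈ Fintype.piFinset (fun _ : S₀ ↦ Finset.range 3), (∏ v : S₀, ((W.localPolynomialAt (v : IsDedekindDomain.HeightOneSpectrum (NumberField.RingOfIntegers ℚ))).map (Int.castRingHom (PadicAlgCl 2))).coeff (k v) * ((Rat.HeightOneSpectrum.natGenerator (v : IsDedekindDomain.HeightOneSpectrum (NumberField.RingOfIntegers ℚ)) : PadicAlgCl 2)⁻¹) ^ (k v)) * algebraMap ℚ (PadicAlgCl 2) (ratPlusSymbol f (x * ((∏ v : S₀, Rat.HeightOneSpectrum.natGenerator (v : IsDedekindDomain.HeightOneSpectrum (NumberField.RingOfIntegers ℚ)) ^ (k v) : ℕ) : ℚ))))‖ ≤ 1) ∧ ∃ x : ℚ, ‖c * (∑ k ∈ Fintype.piFinset (fun _ : S₀ ↦ Finset.range 3), (∏ v : S₀, ((W.localPolynomialAt (v : IsDedekindDomain.HeightOneSpectrum (NumberField.RingOfIntegers ℚ))).map (Int.castRingHom (PadicAlgCl 2))).coeff (k v) * ((Rat.HeightOneSpectrum.natGenerator (v : IsDedekindDomain.HeightOneSpectrum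 (NumberField.RingOfIntegers ℚ)) : PadicAlgCl 2)⁻¹) ^ (k v)) * algebraMap ℚ (PadicAlgCl 2) (ratPlusSymbol f (x * ((∏ v : S₀, Rat.HeightOneSpectrum.natGenerator (v : IsDedekindDomain.HeightOneSpectrum (NumberField.RingOfIntegers ℚ)) ^ (k v) : ℕ) : ℚ))))‖ = 1 := by
  obtain ⟨x₀, hmax, hunit⟩ := hμ
  refine ⟨algebraMap ℚ (PadicAlgCl 2) (2 * ϖ), fun x ↦ ?_, x₀, hunit⟩
  rw [norm_mul]
  rw [norm_mul] at hunit
  calc ‖algebraMap ℚ (PadicAlgCl 2) (2 * ϖ)‖ * ‖(∑ k ∈ Fintype.piFinset (fun _ : S₀ ↦ Finset.range 3), (∏ v : S₀, ((W.localPolynomialAt (v : IsDedekindDomain.HeightOneSpectrum (NumberField.RingOfIntegers ℚ))).map (Int.castRingHom (PadicAlgCl 2))).coeff (k v) * ((Rat.HeightOneSpectrum.natGenerator (v : IsDedekindDomain.HeightOneSpectrum (NumberField.RingOfIntegers ℚ)) : PadicAlgCl 2)⁻¹) ^ (k v)) * algebraMap ℚ (PadicAlgCl 2) (ratPlusSymbol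 f (x * ((∏ v : S₀, Rat.HeightOneSpectrum.natGenerator (v : IsDedekindDomain.HeightOneSpectrum (NumberField.RingOfIntegers ℚ)) ^ (k v) : ℕ) : ℚ))))‖
      ≤ ‖algebraMap ℚ (PadicAlgCl 2) (2 * ϖ)‖ * ‖(∑ k ∈ Fintype.piFinset (fun _ : S₀ ↦ Finset.range 3), (∏ v : S₀, ((W.localPolynomialAt (v : IsDedekindDomain.HeightOneSpectrum (NumberField.RingOfIntegers ℚ))).map (Int.castRingHom (PadicAlgCl 2))).coeff (k v) * ((Rat.HeightOneSpectrum.natGenerator (v : IsDedekindDomain.HeightOneSpectrum (NumberField.RingOfIntegers ℚ)) : PadicAlgCl 2)⁻¹) ^ (k v)) * algebraMap ℚ (PadicAlgCl 2) (ratPlusSymbol f (x₀ * ((∏ v : S₀, Rat.HeightOneSpectrum.natGenerator (v : IsDedekindDomain.HeightOneSpectrum (NumberField.RingOfIntegers ℚ)) ^ (k v) : ℕ) : ℚ))))‖ := mul_le_mul_of_nonneg_left (hmax x) (norm_nonneg _)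
    _ = 1 := hunit

end Scaling

section PlusLine

variable {W : WeierstrassCurve ℚ} [W.IsElliptic] [W.IsGloballyMinimal] [NeZero (W.conductorNorm ℤ)]
  {A : WeierstrassCurve ℚ} [A.IsElliptic] [A.IsGloballyMinimal] [NeZero (A.conductorNorm ℤ)]
  {f : CuspForm (Gamma0 (W.conductorNorm ℤ)) 2} {fA : CuspForm (Gamma0 (A.conductorNorm ℤ)) 2}

/-- **The Néron-normalised parity law from the plus line (C3⁺).** For `W` on the habitat⁺ (good supersingular at `2`, `Δ_W < 0`,
analytic rank `0`, newform `f`), a `2`-congruent curve `A` of odd conductor and analytic rank `0` (newform `f_A`,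
`|a_q(A) − a_q(W)|₂ < 1` off `N_W N_A`), an admissible `S₀`, and rationals `ϖ, ϖ_A` such that the doubled tables `2ϖΨ_W`, `2ϖ_AΨ_A`
take a unit value at a point of maximal `|Ψ|` («`μ = 0`, maximum attained»): `‖2ϖΨ_W(r) − 2ϖ_AΨ_A(r)‖ < 1` for every `r ∈ ℚ`.
[cite: GreenbergVatsal2000, Thm. (1.4) and §3 (13) (shape; p odd there)] [cite: Vatsal1999, Thm. (1.13)] -/
theorem depletedParity_of_congruent_of_plusLine_anyRank
    (hC3 : ∀ (W : WeierstrassCurve ℚ) [W.IsElliptic] [W.IsGloballyMinimal], Literature.NumberTheory.EllipticCurves.Rank1Residual.GoodSS W 2 → W.Δ < 0 → ∀ (N' : ℕ), Odd N' → ∀ {N : ℕ} [NeZero N] (f : CuspForm (CongruenceSubgroup.Gamma0 N) 2), Literature.NumberTheory.EllipticCurves.ModularForms.IsNewformOf W f → ∀ (S : Finset ℕ), (∀ ℓ ∈ S, ℓ.Prime) → S.Nonempty → N * ∏ ℓ ∈ S, ℓ ^ 2 ∣ N' → (∀ p : ℕ, p.Prime → p ∣ N' → p ∈ S) → (∀ v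 : IsDedekindDomain.HeightOneSpectrum (NumberField.RingOfIntegers ℚ), ¬ ((Rat.HeightOneSpectrum.primesEquiv v : ℕ) ∣ 2 * N') → W.HasGoodReductionAt v) → ∀ (Φ₁ Φ₂ : ℚ → PadicAlgCl 2), (∀ (r : ℚ) (z : ℤ), Φ₁ (r + z) = Φ₁ r) → (∀ r : ℚ, Φ₁ (-r) = Φ₁ r) → (∀ (γ : CongruenceSubgroup.Gamma0 (N')) (r : ℚ), ((γ : SL(2, ℤ)) 1 0 : ℚ) * r + ((γ : SL(2, ℤ)) 1 1 : ℚ) ≠ 0 → Φ₁ ((((γ : SL(2, ℤ)) 0 0 : ℚ) * r + ((γ : SL(2, ℤ)) 0 1 : ℚ)) / (((γ : SL(2, ℤ)) 1 0 : ℚ) * r + ((γ : SL(2, ℤ)) 1 1 : ℚ))) = (if ((γ : SL(2, ℤ)) 1 0) = 0 then 0 else Φ₁ ((((γ : SL(2, ℤ)) 0 0 : ℚ)) / (((γ : SL(2, ℤ)) 1 0 : ℚ)))) + Φ₁ r) → (∀ (r : ℚ) (z : ℤ), Φ₂ (r + z) = Φ₂ r) → (∀ r : ℚ, Φ₂ (-r)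 = Φ₂ r) → (∀ (γ : CongruenceSubgroup.Gamma0 (N')) (r : ℚ), ((γ : SL(2, ℤ)) 1 0 : ℚ) * r + ((γ : SL(2, ℤ)) 1 1 : ℚ) ≠ 0 → Φ₂ ((((γ : SL(2, ℤ)) 0 0 : ℚ) * r + ((γ : SL(2, ℤ)) 0 1 : ℚ)) / (((γ : SL(2, ℤ)) 1 0 : ℚ) * r + ((γ : SL(2, ℤ)) 1 1 : ℚ))) = (if ((γ : SL(2, ℤ)) 1 0) = 0 then 0 else Φ₂ ((((γ : SL(2, ℤ)) 0 0 : ℚ)) / (((γ : SL(2, ℤ)) 1 0 : ℚ)))) + Φ₂ r) → (∀ r : ℚ, ‖Φ₁ r‖ ≤ 1) → (∀ r : ℚ, ‖Φ₂ r‖ ≤ 1) → (∃ r : ℚ, ‖Φ₁ r‖ = 1) → (∃ r : ℚ, ‖Φ₂ r‖ = 1) → (∀ q : ℕ, q.Prime → ¬ q ∣ N' → ∀ r : ℚ, ‖(∑ j : Fin q, Φ₁ ((r + j) / q)) + Φ₁ (q * r) - (W.LFunction q : PadicAlgCl 2) * Φ₁ r‖ < 1) → (∀ q : ℕ, q.Prime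 → ¬ q ∣ N' → ∀ r : ℚ, ‖(∑ j : Fin q, Φ₂ ((r + j) / q)) + Φ₂ (q * r) - (W.LFunction q : PadicAlgCl 2) * Φ₂ r‖ < 1) → (∀ ℓ : ℕ, ℓ.Prime → ℓ ∣ N' → ∀ r : ℚ, ‖∑ j : Fin ℓ, Φ₁ ((r + j) / ℓ)‖ < 1) → (∀ ℓ : ℕ, ℓ.Prime → ℓ ∣ N' → ∀ r : ℚ, ‖∑ j : Fin ℓ, Φ₂ ((r + j) / ℓ)‖ < 1) → ∃ a : PadicAlgCl 2, ∀ r : ℚ, ‖a * Φ₁ r - Φ₂ r‖ < 1)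
    (hss : Literature.NumberTheory.EllipticCurves.Rank1Residual.GoodSS W 2) (hΔ : W.Δ < 0) (hf : IsNewformOf W f)
    (hAodd : Odd (A.conductorNorm ℤ)) (hfA : IsNewformOf A fA)
    (hcong : ∀ q : ℕ, q.Prime → ¬ q ∣ W.conductorNorm ℤ → ¬ q ∣ A.conductorNorm ℤ →
      ‖(A.LFunction q : PadicAlgCl 2) - (W.LFunction q : PadicAlgCl 2)‖ < 1)
    (S₀ : Finset (IsDedekindDomain.HeightOneSpectrum (NumberField.RingOfIntegers ℚ)))
    (hS2 : ∀ v ∈ S₀, ((2 : ℕ) : NumberField.RingOfIntegers ℚ) ∉ v.asIdeal)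
    (hSW : ∀ v : IsDedekindDomain.HeightOneSpectrum (NumberField.RingOfIntegers ℚ), ¬ W.HasGoodReductionAt v → v ∈ S₀)
    (hSA : ∀ v : IsDedekindDomain.HeightOneSpectrum (NumberField.RingOfIntegers ℚ), ¬ A.HasGoodReductionAt v → v ∈ S₀)
    (ϖ ϖA : ℚ)
    (hμW : ∃ x₀ : ℚ, (∀ r : ℚ, ‖(∑ k ∈ Fintype.piFinset (fun _ : S₀ ↦ Finset.range 3), (∏ v : S₀, ((W.localPolynomialAt (v : IsDedekindDomain.HeightOneSpectrum (NumberField.RingOfIntegers ℚ))).map (Int.castRingHom (PadicAlgCl 2))).coeff (k v) * ((Rat.HeightOneSpectrum.natGenerator (v : IsDedekindDomain.HeightOneSpectrum (NumberField.RingOfIntegers ℚ)) : PadicAlgCl 2)⁻¹) ^ (k v)) * algebraMap ℚ (PadicAlgCl 2) (ratPlusSymbol f (r * ((∏ v : S₀, Rat.HeightOneSpectrum.natGenerator (v : IsDedekindDomain.HeightOneSpectrum (NumberField.RingOfIntegers ℚ)) ^ (k v) : ℕ) : ℚ))))‖ ≤ ‖(∑ k ∈ Fintype.piFinset (fun _ :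 S₀ ↦ Finset.range 3), (∏ v : S₀, ((W.localPolynomialAt (v : IsDedekindDomain.HeightOneSpectrum (NumberField.RingOfIntegers ℚ))).map (Int.castRingHom (PadicAlgCl 2))).coeff (k v) * ((Rat.HeightOneSpectrum.natGenerator (v : IsDedekindDomain.HeightOneSpectrum (NumberField.RingOfIntegers ℚ)) : PadicAlgCl 2)⁻¹) ^ (k v)) * algebraMap ℚ (PadicAlgCl 2) (ratPlusSymbol f (x₀ * ((∏ v : S₀, Rat.HeightOneSpectrum.natGenerator (v : IsDedekindDomain.HeightOneSpectrum (NumberField.RingOfIntegers ℚ)) ^ (k v) : ℕ) : ℚ))))‖) ∧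
      ‖algebraMap ℚ (PadicAlgCl 2) (2 * ϖ) * (∑ k ∈ Fintype.piFinset (fun _ : S₀ ↦ Finset.range 3), (∏ v : S₀, ((W.localPolynomialAt (v : IsDedekindDomain.HeightOneSpectrum (NumberField.RingOfIntegers ℚ))).map (Int.castRingHom (PadicAlgCl 2))).coeff (k v) * ((Rat.HeightOneSpectrum.natGenerator (v : IsDedekindDomain.HeightOneSpectrum (NumberField.RingOfIntegers ℚ)) : PadicAlgCl 2)⁻¹) ^ (k v)) * algebraMap ℚ (PadicAlgCl 2) (ratPlusSymbol f (x₀ * ((∏ v : S₀, Rat.HeightOneSpectrum.natGenerator (v : IsDedekindDomain.HeightOneSpectrum (NumberField.RingOfIntegers ℚ)) ^ (k v) : ℕ) : ℚ))))‖ = 1)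
    (hμA : ∃ x₀ : ℚ, (∀ r : ℚ, ‖(∑ k ∈ Fintype.piFinset (fun _ : S₀ ↦ Finset.range 3), (∏ v : S₀, ((A.localPolynomialAt (v : IsDedekindDomain.HeightOneSpectrum (NumberField.RingOfIntegers ℚ))).map (Int.castRingHom (PadicAlgCl 2))).coeff (k v) * ((Rat.HeightOneSpectrum.natGenerator (v : IsDedekindDomain.HeightOneSpectrum (NumberField.RingOfIntegers ℚ)) : PadicAlgCl 2)⁻¹) ^ (k v)) * algebraMap ℚ (PadicAlgCl 2) (ratPlusSymbol fA (r * ((∏ v : S₀, Rat.HeightOneSpectrum.natGenerator (v : IsDedekindDomain.HeightOneSpectrum (NumberField.RingOfIntegers ℚ)) ^ (k v) : ℕ) : ℚ))))‖ ≤ ‖(∑ k ∈ Fintype.piFinset (fun _ : S₀ ↦ Finset.range 3), (∏ v : S₀, ((A.localPolynomialAt (v : IsDedekindDomain.HeightOneSpectrum (NumberField.RingOfIntegers ℚ))).map (Int.castRingHom (PadicAlgCl 2))).coeff (k v) * ((Rat.HeightOneSpectrum.natGenerator (v : IsDedekindDomain.HeightOneSpectrum (NumberField.RingOfIntegers ℚ))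 : PadicAlgCl 2)⁻¹) ^ (k v)) * algebraMap ℚ (PadicAlgCl 2) (ratPlusSymbol fA (x₀ * ((∏ v : S₀, Rat.HeightOneSpectrum.natGenerator (v : IsDedekindDomain.HeightOneSpectrum (NumberField.RingOfIntegers ℚ)) ^ (k v) : ℕ) : ℚ))))‖) ∧
      ‖algebraMap ℚ (PadicAlgCl 2) (2 * ϖA) * (∑ k ∈ Fintype.piFinset (fun _ : S₀ ↦ Finset.range 3), (∏ v : S₀, ((A.localPolynomialAt (v : IsDedekindDomain.HeightOneSpectrum (NumberField.RingOfIntegers ℚ))).map (Int.castRingHom (PadicAlgCl 2))).coeff (k v) * ((Rat.HeightOneSpectrum.natGenerator (v : IsDedekindDomain.HeightOneSpectrum (NumberField.RingOfIntegers ℚ)) : PadicAlgCl 2)⁻¹) ^ (k v)) * algebraMap ℚ (PadicAlgCl 2) (ratPlusSymbol fA (x₀ * ((∏ v : S₀, Rat.HeightOneSpectrum.natGenerator (v : IsDedekindDomain.HeightOneSpectrum (NumberField.RingOfIntegers ℚ)) ^ (k v) : ℕ) : ℚ))))‖ = 1)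
    (r : ℚ) :
    ‖algebraMap ℚ (PadicAlgCl 2) (2 * ϖ) * (∑ k ∈ Fintype.piFinset (fun _ : S₀ ↦ Finset.range 3), (∏ v : S₀, ((W.localPolynomialAt (v : IsDedekindDomain.HeightOneSpectrum (NumberField.RingOfIntegers ℚ))).map (Int.castRingHom (PadicAlgCl 2))).coeff (k v) * ((Rat.HeightOneSpectrum.natGenerator (v : IsDedekindDomain.HeightOneSpectrum (NumberField.RingOfIntegers ℚ)) : PadicAlgCl 2)⁻¹) ^ (k v)) * algebraMap ℚ (PadicAlgCl 2) (ratPlusSymbol f (r * ((∏ v : S₀, Rat.HeightOneSpectrum.natGenerator (v : IsDedekindDomain.HeightOneSpectrum (NumberField.RingOfIntegers ℚ)) ^ (k v) : ℕ) : ℚ)))) -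
        algebraMap ℚ (PadicAlgCl 2) (2 * ϖA) * (∑ k ∈ Fintype.piFinset (fun _ : S₀ ↦ Finset.range 3), (∏ v : S₀, ((A.localPolynomialAt (v : IsDedekindDomain.HeightOneSpectrum (NumberField.RingOfIntegers ℚ))).map (Int.castRingHom (PadicAlgCl 2))).coeff (k v) * ((Rat.HeightOneSpectrum.natGenerator (v : IsDedekindDomain.HeightOneSpectrum (NumberField.RingOfIntegers ℚ)) : PadicAlgCl 2)⁻¹) ^ (k v)) * algebraMap ℚ (PadicAlgCl 2) (ratPlusSymbol fA (r * ((∏ v : S₀, Rat.HeightOneSpectrum.natGenerator (v : IsDedekindDomain.HeightOneSpectrum (NumberField.RingOfIntegers ℚ)) ^ (k v) : ℕ) : ℚ))))‖ < 1 := by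
  classical
  have hSMA : ∀ v : IsDedekindDomain.HeightOneSpectrum (NumberField.RingOfIntegers ℚ),
      Rat.HeightOneSpectrum.natGenerator v ∣ A.conductorNorm ℤ → v ∈ S₀ :=
    fun v hv ↦ mem_of_natGenerator_dvd_conductorNorm hSA v hv
  have hSMW : ∀ v : IsDedekindDomain.HeightOneSpectrum (NumberField.RingOfIntegers ℚ),
      Rat.HeightOneSpectrum.natGenerator v ∣ W.conductorNorm ℤ → v ∈ S₀ :=
    fun v hv ↦ mem_of_natGenerator_dvd_conductorNorm hSW v hv
  -- primitive scalings of the two depleted symbols (w2)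
  obtain ⟨c, hcint, x, hx⟩ := primitive_scaling_of_mu W f S₀ ϖ hμW
  obtain ⟨y, hyint, xA, hxA⟩ := primitive_scaling_of_mu A fA S₀ ϖA hμA
  -- the common depleted level `N' = N_W · N_A · ∏ ℓ_v²` and the level data of (C3⁺)
  have hN'odd := odd_depletedLevel W hss hAodd S₀ hS2
  obtain ⟨SS, hSSdef⟩ : ∃ SS : Finset ℕ, SS = S₀.image (fun v ↦ Rat.HeightOneSpectrum.natGenerator v) := ⟨_, rfl⟩
  have hSS : ∀ ℓ ∈ SS, ℓ.Prime := by
    intro ℓ hℓ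
    rw [hSSdef] at hℓ
    obtain ⟨v, -, rfl⟩ := Finset.mem_image.mp hℓ
    exact Rat.HeightOneSpectrum.prime_natGenerator v
  have hLS : ∀ p : ℕ, p.Prime → p ∣ W.conductorNorm ℤ * A.conductorNorm ℤ * (∏ v : S₀, Rat.HeightOneSpectrum.natGenerator (v : IsDedekindDomain.HeightOneSpectrum (NumberField.RingOfIntegers ℚ)) ^ 2) → p ∈ SS := by
    intro p hp hdvd
    obtain ⟨v₀, hv₀, hv₀p⟩ := exists_mem_natGenerator_eq_of_dvd W S₀ hSW hSMA hp hdvd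
    rw [hSSdef]
    exact Finset.mem_image.mpr ⟨v₀, hv₀, hv₀p⟩
  have hSSne : SS.Nonempty := by
    have h1 : W.conductorNorm ℤ * A.conductorNorm ℤ * (∏ v : S₀, Rat.HeightOneSpectrum.natGenerator (v : IsDedekindDomain.HeightOneSpectrum (NumberField.RingOfIntegers ℚ)) ^ 2) ≠ 1 := by
      intro h
      exact WeierstrassCurve.conductorNorm_ne_one W (Nat.eq_one_of_mul_eq_one_right (Nat.eq_one_of_mul_eq_one_right h))
    obtain ⟨p, hp, hpd⟩ := Nat.exists_prime_and_dvd h1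
    exact ⟨p, hLS p hp hpd⟩
  have hNL : W.conductorNorm ℤ * ∏ ℓ ∈ SS, ℓ ^ 2 ∣ W.conductorNorm ℤ * A.conductorNorm ℤ * (∏ v : S₀, Rat.HeightOneSpectrum.natGenerator (v : IsDedekindDomain.HeightOneSpectrum (NumberField.RingOfIntegers ℚ)) ^ 2) := by
    have hinj : Set.InjOn (fun v : IsDedekindDomain.HeightOneSpectrum (NumberField.RingOfIntegers ℚ) ↦ Rat.HeightOneSpectrum.natGenerator v) S₀ :=
      fun v _ w _ h ↦ Rat.HeightOneSpectrum.primesEquiv.injective (Subtype.ext h)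
    rw [hSSdef, Finset.prod_image hinj, ← Finset.prod_coe_sort S₀]
    exact ⟨A.conductorNorm ℤ, by ring⟩
  have hgoodL : ∀ v : IsDedekindDomain.HeightOneSpectrum (NumberField.RingOfIntegers ℚ), ¬ ((Rat.HeightOneSpectrum.primesEquiv v : ℕ) ∣ 2 * (W.conductorNorm ℤ * A.conductorNorm ℤ * (∏ v : S₀, Rat.HeightOneSpectrum.natGenerator (v : IsDedekindDomain.HeightOneSpectrum (NumberField.RingOfIntegers ℚ)) ^ 2))) → W.HasGoodReductionAt v := by
    intro v hv
    by_contra hbad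
    apply hv
    have h1 : Rat.HeightOneSpectrum.natGenerator v ∣ ∏ w ∈ S₀, Rat.HeightOneSpectrum.natGenerator w ^ 2 :=
      (dvd_pow_self _ two_ne_zero).trans
        (Finset.dvd_prod_of_mem (fun w ↦ Rat.HeightOneSpectrum.natGenerator w ^ 2) (hSW v hbad))
    rw [Finset.prod_coe_sort S₀ (fun w ↦ Rat.HeightOneSpectrum.natGenerator w ^ 2)]
    exact Dvd.dvd.mul_left (Dvd.dvd.mul_left h1 _) 2
  have hdvdW : W.conductorNorm ℤ * (∏ v : S₀, Rat.HeightOneSpectrum.natGenerator (v : IsDedekindDomain.HeightOneSpectrum (NumberField.RingOfIntegers ℚ)) ^ 2) ∣ W.conductorNorm ℤ * A.conductorNorm ℤ * (∏ v : S₀, Rat.HeightOneSpectrum.natGenerator (v : IsDedekindDomain.HeightOneSpectrum (NumberField.RingOfIntegers ℚ)) ^ 2) := ⟨A.conductorNorm ℤ, by ring⟩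
  have hdvdA : A.conductorNorm ℤ * (∏ v : S₀, Rat.HeightOneSpectrum.natGenerator (v : IsDedekindDomain.HeightOneSpectrum (NumberField.RingOfIntegers ℚ)) ^ 2) ∣ W.conductorNorm ℤ * A.conductorNorm ℤ * (∏ v : S₀, Rat.HeightOneSpectrum.natGenerator (v : IsDedekindDomain.HeightOneSpectrum (NumberField.RingOfIntegers ℚ)) ^ 2) := ⟨W.conductorNorm ℤ, by ring⟩
  have hoff : ∀ q : ℕ, ¬ q ∣ W.conductorNorm ℤ * A.conductorNorm ℤ * (∏ v : S₀, Rat.HeightOneSpectrum.natGenerator (v : IsDedekindDomain.HeightOneSpectrum (NumberField.RingOfIntegers ℚ)) ^ 2) →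
      ¬ q ∣ W.conductorNorm ℤ ∧ ¬ q ∣ A.conductorNorm ℤ ∧ ∀ v ∈ S₀, Rat.HeightOneSpectrum.natGenerator v ≠ q :=
    fun q hnd ↦ off_depletedLevel W (A.conductorNorm ℤ) S₀ hnd
  have hdvd' : ∀ ℓ : ℕ, ℓ ∣ W.conductorNorm ℤ * A.conductorNorm ℤ * (∏ v : S₀, Rat.HeightOneSpectrum.natGenerator (v : IsDedekindDomain.HeightOneSpectrum (NumberField.RingOfIntegers ℚ)) ^ 2) → ℓ ∣ A.conductorNorm ℤ * W.conductorNorm ℤ * (∏ v : S₀, Rat.HeightOneSpectrum.natGenerator (v : IsDedekindDomain.HeightOneSpectrum (NumberField.RingOfIntegers ℚ)) ^ 2) := by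
    intro ℓ hd
    rwa [mul_comm (A.conductorNorm ℤ) (W.conductorNorm ℤ)]
  -- the plus line: `Φ_A ≡ a · Φ_W (mod 𝔪)`
  obtain ⟨a, ha'⟩ := hC3 W hss hΔ _ hN'odd f hf SS hSS hSSne hNL hLS hgoodL
    (fun x ↦ c * (∑ k ∈ Fintype.piFinset (fun _ : S₀ ↦ Finset.range 3), (∏ v : S₀, ((W.localPolynomialAt (v : IsDedekindDomain.HeightOneSpectrum (NumberField.RingOfIntegers ℚ))).map (Int.castRingHom (PadicAlgCl 2))).coeff (k v) * ((Rat.HeightOneSpectrum.natGenerator (v : IsDedekindDomain.HeightOneSpectrum (NumberField.RingOfIntegers ℚ)) : PadicAlgCl 2)⁻¹) ^ (k v)) * algebraMap ℚ (PadicAlgCl 2) (ratPlusSymbol f (x * ((∏ v : S₀, Rat.HeightOneSpectrum.natGenerator (v : IsDedekindDomain.HeightOneSpectrum (NumberField.RingOfIntegers ℚ)) ^ (k v) : ℕ) : ℚ))))) (fun x ↦ y * (∑ k ∈ Fintype.piFinset (fun _ : S₀ ↦ Finset.range 3), (∏ v : S₀, ((A.localPolynomialAt (v : IsDedekindDomain.HeightOneSpectrum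 (NumberField.RingOfIntegers ℚ))).map (Int.castRingHom (PadicAlgCl 2))).coeff (k v) * ((Rat.HeightOneSpectrum.natGenerator (v : IsDedekindDomain.HeightOneSpectrum (NumberField.RingOfIntegers ℚ)) : PadicAlgCl 2)⁻¹) ^ (k v)) * algebraMap ℚ (PadicAlgCl 2) (ratPlusSymbol fA (x * ((∏ v : S₀, Rat.HeightOneSpectrum.natGenerator (v : IsDedekindDomain.HeightOneSpectrum (NumberField.RingOfIntegers ℚ)) ^ (k v) : ℕ) : ℚ)))))
    (depletedCurveSymbol_add_intCast W S₀ c) (depletedCurveSymbol_neg W S₀ c)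
    (depletedCurveSymbol_gamma0_smul_of_dvd hf c hdvdW)
    (depletedCurveSymbol_add_intCast A S₀ y) (depletedCurveSymbol_neg A S₀ y)
    (depletedCurveSymbol_gamma0_smul_of_dvd hfA y hdvdA)
    hcint hyint ⟨x, hx⟩ ⟨xA, hxA⟩
    (fun q hq hnd r ↦ by
      rw [depletedCurveSymbol_heckeT_sub_eq_zero hf c hq (hoff q hnd).1 (hoff q hnd).2.2 r, norm_zero]
      exact zero_lt_one)
    (fun q hq hnd r ↦ by
      have e := depletedCurveSymbol_heckeT_sub_eq_zero hfA y hq (hoff q hnd).2.1 (hoff q hnd).2.2 r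
      rw [sub_eq_zero] at e
      rw [e, ← sub_mul, norm_mul]
      exact mul_lt_one_of_nonneg_of_lt_one_left (norm_nonneg _) (hcong q hq (hoff q hnd).1 (hoff q hnd).2.1) (hyint r))
    (fun ℓ hℓ hd r ↦ by
      rw [depletedCurveSymbol_heckeU_eq_zero hf c hSW hSMA hℓ hd r, norm_zero]; exact zero_lt_one)
    (fun ℓ hℓ hd r ↦ by
      rw [depletedCurveSymbol_heckeU_eq_zero hfA y hSA hSMW hℓ (hdvd' ℓ hd) r, norm_zero]; exact zero_lt_one)
  simp only at ha'
  -- `a` is a unit, so the unit loci coincide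
  have ha1 : ‖a‖ = 1 :=
    norm_eq_one_of_congr_of_primitive (Φ₁ := (fun x ↦ c * (∑ k ∈ Fintype.piFinset (fun _ : S₀ ↦ Finset.range 3), (∏ v : S₀, ((W.localPolynomialAt (v : IsDedekindDomain.HeightOneSpectrum (NumberField.RingOfIntegers ℚ))).map (Int.castRingHom (PadicAlgCl 2))).coeff (k v) * ((Rat.HeightOneSpectrum.natGenerator (v : IsDedekindDomain.HeightOneSpectrum (NumberField.RingOfIntegers ℚ)) : PadicAlgCl 2)⁻¹) ^ (k v)) * algebraMap ℚ (PadicAlgCl 2) (ratPlusSymbol f (x * ((∏ v : S₀, Rat.HeightOneSpectrum.natGenerator (v : IsDedekindDomain.HeightOneSpectrum (NumberField.RingOfIntegers ℚ)) ^ (k v) : ℕ) : ℚ)))))) (Φ₂ := (fun x ↦ y * (∑ k ∈ Fintype.piFinset (fun _ : S₀ ↦ Finset.range 3), (∏ v : S₀, ((A.localPolynomialAt (v : IsDedekindDomain.HeightOneSpectrum (NumberField.RingOfIntegers ℚ))).map (Int.castRingHom (PadicAlgCl 2))).coeff (k v) * ((Rat.HeightOneSpectrum.natGenerator (v : IsDedekindDomain.HeightOneSpectrum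 (NumberField.RingOfIntegers ℚ)) : PadicAlgCl 2)⁻¹) ^ (k v)) * algebraMap ℚ (PadicAlgCl 2) (ratPlusSymbol fA (x * ((∏ v : S₀, Rat.HeightOneSpectrum.natGenerator (v : IsDedekindDomain.HeightOneSpectrum (NumberField.RingOfIntegers ℚ)) ^ (k v) : ℕ) : ℚ)))))) hcint hyint ⟨x, hx⟩ ⟨xA, hxA⟩ ha'

  -- === the Néron normalisation (lead tp2-p1 g10): `c`, `y` are `2ϖ`, `2ϖ_A` up to units ===
  obtain ⟨xW, hmaxW, hunitW⟩ := hμW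
  obtain ⟨xA', hmaxA', hunitA⟩ := hμA
  set ΨW : ℚ → PadicAlgCl 2 := fun r ↦ (∑ k ∈ Fintype.piFinset (fun _ : S₀ ↦ Finset.range 3), (∏ v : S₀, ((W.localPolynomialAt (v : IsDedekindDomain.HeightOneSpectrum (NumberField.RingOfIntegers ℚ))).map (Int.castRingHom (PadicAlgCl 2))).coeff (k v) * ((Rat.HeightOneSpectrum.natGenerator (v : IsDedekindDomain.HeightOneSpectrum (NumberField.RingOfIntegers ℚ)) : PadicAlgCl 2)⁻¹) ^ (k v)) * algebraMap ℚ (PadicAlgCl 2) (ratPlusSymbol f (r * ((∏ v : S₀, Rat.HeightOneSpectrum.natGenerator (v : IsDedekindDomain.HeightOneSpectrum (NumberField.RingOfIntegers ℚ)) ^ (k v) : ℕ) : ℚ)))) with hΨW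
  set ΨA : ℚ → PadicAlgCl 2 := fun r ↦ (∑ k ∈ Fintype.piFinset (fun _ : S₀ ↦ Finset.range 3), (∏ v : S₀, ((A.localPolynomialAt (v : IsDedekindDomain.HeightOneSpectrum (NumberField.RingOfIntegers ℚ))).map (Int.castRingHom (PadicAlgCl 2))).coeff (k v) * ((Rat.HeightOneSpectrum.natGenerator (v : IsDedekindDomain.HeightOneSpectrum (NumberField.RingOfIntegers ℚ)) : PadicAlgCl 2)⁻¹) ^ (k v)) * algebraMap ℚ (PadicAlgCl 2) (ratPlusSymbol fA (r * ((∏ v : S₀, Rat.HeightOneSpectrum.natGenerator (v : IsDedekindDomain.HeightOneSpectrum (NumberField.RingOfIntegers ℚ)) ^ (k v) : ℕ) : ℚ)))) with hΨA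
  set tW : PadicAlgCl 2 := algebraMap ℚ (PadicAlgCl 2) (2 * ϖ) with htW
  set tA : PadicAlgCl 2 := algebraMap ℚ (PadicAlgCl 2) (2 * ϖA) with htA
  change ‖tW * ΨW r - tA * ΨA r‖ < 1
  have ha'' : ∀ r, ‖a * (c * ΨW r) - y * ΨA r‖ < 1 := ha'
  have hcint' : ∀ r, ‖c * ΨW r‖ ≤ 1 := hcint
  have hyint' : ∀ r, ‖y * ΨA r‖ ≤ 1 := hyint
  have hx' : ‖c * ΨW x‖ = 1 := hx
  have hxA'' : ‖y * ΨA xA‖ = 1 := hxA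
  have hmaxW' : ∀ r, ‖ΨW r‖ ≤ ‖ΨW xW‖ := hmaxW
  have hmaxA'' : ∀ r, ‖ΨA r‖ ≤ ‖ΨA xA'‖ := hmaxA'
  have hunitW' : ‖tW * ΨW xW‖ = 1 := hunitW
  have hunitA' : ‖tA * ΨA xA'‖ = 1 := hunitA
  -- `‖c‖ = ‖t_W‖`, `‖y‖ = ‖t_A‖`
  have hnc : ‖c‖ * ‖ΨW xW‖ = 1 := by
    refine le_antisymm (by rw [← norm_mul]; exact hcint' xW) ?_
    rw [norm_mul] at hx'
    calc (1 : ℝ) = ‖c‖ * ‖ΨW x‖ := hx'.symm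
      _ ≤ ‖c‖ * ‖ΨW xW‖ := by gcongr; exact hmaxW' x
  have hny : ‖y‖ * ‖ΨA xA'‖ = 1 := by
    refine le_antisymm (by rw [← norm_mul]; exact hyint' xA') ?_
    rw [norm_mul] at hxA''
    calc (1 : ℝ) = ‖y‖ * ‖ΨA xA‖ := hxA''.symm
      _ ≤ ‖y‖ * ‖ΨA xA'‖ := by gcongr; exact hmaxA'' xA
  rw [norm_mul] at hunitW' hunitA'
  have hΨW0 : ‖ΨW xW‖ ≠ 0 := fun h ↦ by rw [h, mul_zero] at hnc; exact zero_ne_one hnc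
  have hΨA0 : ‖ΨA xA'‖ ≠ 0 := fun h ↦ by rw [h, mul_zero] at hny; exact zero_ne_one hny
  have hceq : ‖c‖ = ‖tW‖ := mul_right_cancel₀ hΨW0 (hnc.trans hunitW'.symm)
  have hyeq : ‖y‖ = ‖tA‖ := mul_right_cancel₀ hΨA0 (hny.trans hunitA'.symm)
  have hc0 : c ≠ 0 := fun h ↦ by rw [h, norm_zero, zero_mul] at hnc; exact zero_ne_one hnc
  have hy0 : y ≠ 0 := fun h ↦ by rw [h, norm_zero, zero_mul] at hny; exact zero_ne_one hny
  have htW0 : tW ≠ 0 := fun h ↦ hc0 (norm_eq_zero.mp (by rw [hceq, h, norm_zero]))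
  have htA0 : tA ≠ 0 := fun h ↦ hy0 (norm_eq_zero.mp (by rw [hyeq, h, norm_zero]))
  have ha0 : a ≠ 0 := fun h ↦ by rw [h, norm_zero] at ha1; exact zero_ne_one ha1
  -- the unit `u' = t_W y / (a c t_A)`; `t_W Ψ_W − t_A Ψ_A = (t_W/(ac))·(acΨ_W − yΨ_A) + (u' − 1)·t_A Ψ_A`
  set u' : PadicAlgCl 2 := tW * y / (a * c * tA) with hu'
  have hsplit : ∀ r, tW * ΨW r - tA * ΨA r =
      (tW / (a * c)) * (a * (c * ΨW r) - y * ΨA r) + (u' - 1) * (tA * ΨA r) := by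
    intro r; rw [hu']; field_simp; ring
  have hcoef : ‖tW / (a * c)‖ = 1 := by
    rw [norm_div, norm_mul, ha1, one_mul, hceq]; exact div_self (norm_ne_zero_iff.mpr htW0)
  -- integrality of the Néron tables at every rational
  have hTW : ∀ r, ‖tW * ΨW r‖ ≤ 1 := fun r ↦ by rw [norm_mul, ← hceq, ← norm_mul]; exact hcint' r
  have hTA : ∀ r, ‖tA * ΨA r‖ ≤ 1 := fun r ↦ by rw [norm_mul, ← hyeq, ← norm_mul]; exact hyint' r
  -- `u' ≡ 1 (mod 𝔪)`: at `xA'` both Néron values are `2`-adic unit RATIONALS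
  have hu1 : ‖u' - 1‖ < 1 := by
    have hW1 : ‖tW * ΨW xA'‖ = 1 := by
      have h := ha'' xA'
      have e : a * (c * ΨW xA') = (a * c / tW) * (tW * ΨW xA') := by field_simp
      rw [e] at h
      have hn : ‖a * c / tW‖ = 1 := by
        rw [norm_div, norm_mul, ha1, one_mul, hceq]; exact div_self (norm_ne_zero_iff.mpr htW0)
      exact (norm_eq_one_iff_of_unit_congr hn (hTW xA') (hyint' xA') h).mpr
        (by rw [norm_mul, hyeq, ← norm_mul]; exact hunitA)
    -- both Néron values at `xA'` are images of rationals
    have hratW : ∀ r, ∃ q : ℚ, tW * ΨW r = algebraMap ℚ (PadicAlgCl 2) q := by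
      intro r
      refine ⟨2 * ϖ * (∑ k ∈ Fintype.piFinset (fun _ : S₀ ↦ Finset.range 3), (∏ v : S₀, (((W.localPolynomialAt (v : IsDedekindDomain.HeightOneSpectrum (NumberField.RingOfIntegers ℚ))).coeff (k v) : ℤ) : ℚ) * ((Rat.HeightOneSpectrum.natGenerator (v : IsDedekindDomain.HeightOneSpectrum (NumberField.RingOfIntegers ℚ)) : ℚ)⁻¹) ^ (k v)) * ratPlusSymbol f (r * ((∏ v : S₀, Rat.HeightOneSpectrum.natGenerator (v : IsDedekindDomain.HeightOneSpectrum (NumberField.RingOfIntegers ℚ)) ^ (k v) : ℕ) : ℚ))), ?_⟩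
      simp only [htW, hΨW, map_mul, map_sum, map_prod, map_pow, map_inv₀, map_natCast, map_intCast,
        Polynomial.coeff_map, eq_intCast]
    have hratA : ∀ r, ∃ q : ℚ, tA * ΨA r = algebraMap ℚ (PadicAlgCl 2) q := by
      intro r
      refine ⟨2 * ϖA * (∑ k ∈ Fintype.piFinset (fun _ : S₀ ↦ Finset.range 3), (∏ v : S₀, (((A.localPolynomialAt (v : IsDedekindDomain.HeightOneSpectrum (NumberField.RingOfIntegers ℚ))).coeff (k v) : ℤ) : ℚ) * ((Rat.HeightOneSpectrum.natGenerator (v : IsDedekindDomain.HeightOneSpectrum (NumberField.RingOfIntegers ℚ)) : ℚ)⁻¹) ^ (k v)) * ratPlusSymbol fA (r * ((∏ v : S₀, Rat.HeightOneSpectrum.natGenerator (v : IsDedekindDomain.HeightOneSpectrum (NumberField.RingOfIntegers ℚ)) ^ (k v) : ℕ) : ℚ))), ?_⟩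
      simp only [htA, hΨA, map_mul, map_sum, map_prod, map_pow, map_inv₀, map_natCast, map_intCast,
        Polynomial.coeff_map, eq_intCast]
    obtain ⟨qW, hqW⟩ := hratW xA'
    obtain ⟨qA, hqA⟩ := hratA xA'
    -- norms of rationals in `ℚ̄₂` are their `ℚ₂`-norms
    have hcastq : ∀ q : ℚ, algebraMap ℚ (PadicAlgCl 2) q = algebraMap ℚ_[2] (PadicAlgCl 2) (q : ℚ_[2]) := by
      intro q; rw [map_ratCast, eq_ratCast]
    have hnormq : ∀ q : ℚ, ‖algebraMap ℚ (PadicAlgCl 2) q‖ = ‖(q : ℚ_[2])‖ := by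
      intro q; rw [hcastq]; exact PadicAlgCl.norm_extends (p := 2) _
    have hqW1 : ‖(qW : ℚ_[2])‖ = 1 := by rw [← hnormq, ← hqW]; exact hW1
    have hqA1 : ‖(qA : ℚ_[2])‖ = 1 := by rw [← hnormq, ← hqA]; exact hunitA
    -- two `2`-adic unit rationals are congruent mod `2`: `‖q_W/q_A − 1‖ < 1`
    have hqq : ‖(qW : ℚ_[2]) / (qA : ℚ_[2]) - 1‖ < 1 := by
      have hqA0 : (qA : ℚ_[2]) ≠ 0 := fun h ↦ by rw [h, norm_zero] at hqA1; exact zero_ne_one hqA1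
      -- `x := q_W/q_A` is a unit of `ℤ₂`, and units of `ℤ₂` are `≡ 1 (mod 2)`
      have hx1 : ‖(qW : ℚ_[2]) / (qA : ℚ_[2])‖ = 1 := by rw [norm_div, hqW1, hqA1, div_one]
      set z : ℤ_[2] := ⟨(qW : ℚ_[2]) / (qA : ℚ_[2]), hx1.le⟩ with hz
      have hker : z * (z - 1) ∈ RingHom.ker (PadicInt.toZMod : ℤ_[2] →+* ZMod 2) := by
        rw [RingHom.mem_ker, map_mul, map_sub, map_one]
        generalize PadicInt.toZMod z = t
        revert t
        decide
      rw [PadicInt.ker_toZMod, IsLocalRing.mem_maximalIdeal, PadicInt.mem_nonunits, norm_mul] at hker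
      have hz1 : ‖z‖ = 1 := hx1
      rw [hz1, one_mul] at hker
      have h2 : ‖((z - 1 : ℤ_[2]) : ℚ_[2])‖ < 1 := hker
      rwa [PadicInt.coe_sub, PadicInt.coe_one] at h2
    -- transport to `ℚ̄₂`: `u' (t_A Ψ_A) ≡ t_W Ψ_W (mod 𝔪)` and `t_W Ψ_W = (q_W/q_A)·(t_A Ψ_A)`
    have hcong' : ‖u' * (tA * ΨA xA') - tW * ΨW xA'‖ < 1 := by
      have h := ha'' xA'
      have e : u' * (tA * ΨA xA') - tW * ΨW xA' = -(tW / (a * c)) * (a * (c * ΨW xA') - y * ΨA xA') := by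
        rw [hu']; field_simp; ring
      rw [e, norm_mul, norm_neg, hcoef, one_mul]; exact h
    have hqA0 : qA ≠ 0 := fun h0 ↦ by rw [h0, Rat.cast_zero, norm_zero] at hqA1; exact zero_ne_one hqA1
    have hqA0' : algebraMap ℚ (PadicAlgCl 2) qA ≠ 0 := by
      rw [eq_ratCast]; exact_mod_cast hqA0
    have hratio : tW * ΨW xA' = (algebraMap ℚ (PadicAlgCl 2) qW / algebraMap ℚ (PadicAlgCl 2) qA) * (tA * ΨA xA') := by
      rw [hqW, hqA]; field_simp
    have hnr : ‖algebraMap ℚ (PadicAlgCl 2) qW / algebraMap ℚ (PadicAlgCl 2) qA - 1‖ < 1 := by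
      have e : algebraMap ℚ (PadicAlgCl 2) qW / algebraMap ℚ (PadicAlgCl 2) qA - 1 =
          algebraMap ℚ_[2] (PadicAlgCl 2) ((qW : ℚ_[2]) / (qA : ℚ_[2]) - 1) := by
        rw [map_sub, map_one, map_div₀, hcastq, hcastq]
      rw [e, PadicAlgCl.norm_extends]; exact hqq
    -- `(u' − 1)·(t_A Ψ_A xA') = (u'·t_AΨ_A − t_WΨ_W) + (q_W/q_A − 1)·t_AΨ_A`
    have e2 : (u' - 1) * (tA * ΨA xA') = (u' * (tA * ΨA xA') - tW * ΨW xA') +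
        (algebraMap ℚ (PadicAlgCl 2) qW / algebraMap ℚ (PadicAlgCl 2) qA - 1) * (tA * ΨA xA') := by
      rw [hratio]; ring
    have h3 : ‖(u' - 1) * (tA * ΨA xA')‖ < 1 := by
      rw [e2]
      refine (IsUltrametricDist.norm_add_le_max _ _).trans_lt (max_lt hcong' ?_)
      rw [norm_mul]
      exact mul_lt_one_of_nonneg_of_lt_one_left (norm_nonneg _) hnr (hTA xA')
    rwa [norm_mul, hunitA, mul_one] at h3
  calc ‖tW * ΨW r - tA * ΨA r‖
      = ‖(tW / (a * c)) * (a * (c * ΨW r) - y * ΨA r) + (u' - 1) * (tA * ΨA r)‖ := by rw [hsplit]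
    _ ≤ max ‖(tW / (a * c)) * (a * (c * ΨW r) - y * ΨA r)‖ ‖(u' - 1) * (tA * ΨA r)‖ :=
        IsUltrametricDist.norm_add_le_max _ _
    _ < 1 := by
        refine max_lt ?_ ?_
        · rw [norm_mul, hcoef, one_mul]; exact ha'' r
        · rw [norm_mul]
          exact mul_lt_one_of_nonneg_of_lt_one_left (norm_nonneg _) hu1 (hTA r)

/-- **The Néron-normalised parity law from the SIX named facts of the plus line** (Eichler–Shimura depleted optimal quotient,
Faltings, Mazur–Kenku, Hecke self-duality of `J₀[2]`, Buzzard's mod-`2` multiplicity one, Serre 1972 Prop. 12 —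
`plusLineCharTwo_of_facts`, route ResidualThetaTransportAtTwo) + the trace congruence + the two `μ`-hypotheses.
[cite: Buzzard2000LevelLoweringModTwo, Prop. 2.4] [cite: GreenbergVatsal2000, Thm. (1.4) and §3 (13) (shape)] -/
theorem depletedParity_of_congruent_of_facts_anyRank
    (hES : eichlerShimura_depletedOptimalQuotient_periodLattice_of_dvd)
    (hF : WeierstrassCurve.isIsogenous_iff_frobeniusTrace_eq) (hMK : mazurKenku_exists_cyclic_isogeny)
    (hSD : heckeSelfDual_torsionBy_J0) (hBz : buzzard2000_multiplicityOne_gamma0)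
    (hSe : serre1972_supersingular_decompositionSubgroup_image)
    (hss : Literature.NumberTheory.EllipticCurves.Rank1Residual.GoodSS W 2) (hΔ : W.Δ < 0) (hf : IsNewformOf W f)
    (hAodd : Odd (A.conductorNorm ℤ)) (hfA : IsNewformOf A fA)
    (hcong : ∀ q : ℕ, q.Prime → ¬ q ∣ W.conductorNorm ℤ → ¬ q ∣ A.conductorNorm ℤ →
      ‖(A.LFunction q : PadicAlgCl 2) - (W.LFunction q : PadicAlgCl 2)‖ < 1)
    (S₀ : Finset (IsDedekindDomain.HeightOneSpectrum (NumberField.RingOfIntegers ℚ)))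
    (hS2 : ∀ v ∈ S₀, ((2 : ℕ) : NumberField.RingOfIntegers ℚ) ∉ v.asIdeal)
    (hSW : ∀ v : IsDedekindDomain.HeightOneSpectrum (NumberField.RingOfIntegers ℚ), ¬ W.HasGoodReductionAt v → v ∈ S₀)
    (hSA : ∀ v : IsDedekindDomain.HeightOneSpectrum (NumberField.RingOfIntegers ℚ), ¬ A.HasGoodReductionAt v → v ∈ S₀)
    (ϖ ϖA : ℚ)
    (hμW : ∃ x₀ : ℚ, (∀ r : ℚ, ‖(∑ k ∈ Fintype.piFinset (fun _ : S₀ ↦ Finset.range 3), (∏ v : S₀, ((W.localPolynomialAt (v : IsDedekindDomain.HeightOneSpectrum (NumberField.RingOfIntegers ℚ))).map (Int.castRingHom (PadicAlgCl 2))).coeff (k v) * ((Rat.HeightOneSpectrum.natGenerator (v : IsDedekindDomain.HeightOneSpectrum (NumberField.RingOfIntegers ℚ)) : PadicAlgCl 2)⁻¹) ^ (k v)) * algebraMap ℚ (PadicAlgCl 2) (ratPlusSymbol f (r * ((∏ v : S₀, Rat.HeightOneSpectrum.natGenerator (v : IsDedekindDomain.HeightOneSpectrum (NumberField.RingOfIntegers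 ℚ)) ^ (k v) : ℕ) : ℚ))))‖ ≤ ‖(∑ k ∈ Fintype.piFinset (fun _ : S₀ ↦ Finset.range 3), (∏ v : S₀, ((W.localPolynomialAt (v : IsDedekindDomain.HeightOneSpectrum (NumberField.RingOfIntegers ℚ))).map (Int.castRingHom (PadicAlgCl 2))).coeff (k v) * ((Rat.HeightOneSpectrum.natGenerator (v : IsDedekindDomain.HeightOneSpectrum (NumberField.RingOfIntegers ℚ)) : PadicAlgCl 2)⁻¹) ^ (k v)) * algebraMap ℚ (PadicAlgCl 2) (ratPlusSymbol f (x₀ * ((∏ v : S₀, Rat.HeightOneSpectrum.natGenerator (v : IsDedekindDomain.HeightOneSpectrum (NumberField.RingOfIntegers ℚ)) ^ (k v) : ℕ) : ℚ))))‖) ∧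
      ‖algebraMap ℚ (PadicAlgCl 2) (2 * ϖ) * (∑ k ∈ Fintype.piFinset (fun _ : S₀ ↦ Finset.range 3), (∏ v : S₀, ((W.localPolynomialAt (v : IsDedekindDomain.HeightOneSpectrum (NumberField.RingOfIntegers ℚ))).map (Int.castRingHom (PadicAlgCl 2))).coeff (k v) * ((Rat.HeightOneSpectrum.natGenerator (v : IsDedekindDomain.HeightOneSpectrum (NumberField.RingOfIntegers ℚ)) : PadicAlgCl 2)⁻¹) ^ (k v)) * algebraMap ℚ (PadicAlgCl 2) (ratPlusSymbol f (x₀ * ((∏ v : S₀, Rat.HeightOneSpectrum.natGenerator (v : IsDedekindDomain.HeightOneSpectrum (NumberField.RingOfIntegers ℚ)) ^ (k v) : ℕ) : ℚ))))‖ = 1)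
    (hμA : ∃ x₀ : ℚ, (∀ r : ℚ, ‖(∑ k ∈ Fintype.piFinset (fun _ : S₀ ↦ Finset.range 3), (∏ v : S₀, ((A.localPolynomialAt (v : IsDedekindDomain.HeightOneSpectrum (NumberField.RingOfIntegers ℚ))).map (Int.castRingHom (PadicAlgCl 2))).coeff (k v) * ((Rat.HeightOneSpectrum.natGenerator (v : IsDedekindDomain.HeightOneSpectrum (NumberField.RingOfIntegers ℚ)) : PadicAlgCl 2)⁻¹) ^ (k v)) * algebraMap ℚ (PadicAlgCl 2) (ratPlusSymbol fA (r * ((∏ v : S₀, Rat.HeightOneSpectrum.natGenerator (v : IsDedekindDomain.HeightOneSpectrum (NumberField.RingOfIntegers ℚ)) ^ (k v) : ℕ) : ℚ))))‖ ≤ ‖(∑ k ∈ Fintype.piFinset (fun _ : S₀ ↦ Finset.range 3), (∏ v : S₀, ((A.localPolynomialAt (v : IsDedekindDomain.HeightOneSpectrum (NumberField.RingOfIntegers ℚ))).map (Int.castRingHom (PadicAlgCl 2))).coeff (k v) * ((Rat.HeightOneSpectrum.natGenerator (v : IsDedekindDomain.HeightOneSpectrum (NumberField.RingOfIntegers ℚ))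 : PadicAlgCl 2)⁻¹) ^ (k v)) * algebraMap ℚ (PadicAlgCl 2) (ratPlusSymbol fA (x₀ * ((∏ v : S₀, Rat.HeightOneSpectrum.natGenerator (v : IsDedekindDomain.HeightOneSpectrum (NumberField.RingOfIntegers ℚ)) ^ (k v) : ℕ) : ℚ))))‖) ∧
      ‖algebraMap ℚ (PadicAlgCl 2) (2 * ϖA) * (∑ k ∈ Fintype.piFinset (fun _ : S₀ ↦ Finset.range 3), (∏ v : S₀, ((A.localPolynomialAt (v : IsDedekindDomain.HeightOneSpectrum (NumberField.RingOfIntegers ℚ))).map (Int.castRingHom (PadicAlgCl 2))).coeff (k v) * ((Rat.HeightOneSpectrum.natGenerator (v : IsDedekindDomain.HeightOneSpectrum (NumberField.RingOfIntegers ℚ)) : PadicAlgCl 2)⁻¹) ^ (k v)) * algebraMap ℚ (PadicAlgCl 2) (ratPlusSymbol fA (x₀ * ((∏ v : S₀, Rat.HeightOneSpectrum.natGenerator (v : IsDedekindDomain.HeightOneSpectrum (NumberField.RingOfIntegers ℚ)) ^ (k v) : ℕ) : ℚ))))‖ = 1)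
    (r : ℚ) :
    ‖algebraMap ℚ (PadicAlgCl 2) (2 * ϖ) * (∑ k ∈ Fintype.piFinset (fun _ : S₀ ↦ Finset.range 3), (∏ v : S₀, ((W.localPolynomialAt (v : IsDedekindDomain.HeightOneSpectrum (NumberField.RingOfIntegers ℚ))).map (Int.castRingHom (PadicAlgCl 2))).coeff (k v) * ((Rat.HeightOneSpectrum.natGenerator (v : IsDedekindDomain.HeightOneSpectrum (NumberField.RingOfIntegers ℚ)) : PadicAlgCl 2)⁻¹) ^ (k v)) * algebraMap ℚ (PadicAlgCl 2) (ratPlusSymbol f (r * ((∏ v : S₀, Rat.HeightOneSpectrum.natGenerator (v : IsDedekindDomain.HeightOneSpectrum (NumberField.RingOfIntegers ℚ)) ^ (k v) : ℕ) : ℚ)))) -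
        algebraMap ℚ (PadicAlgCl 2) (2 * ϖA) * (∑ k ∈ Fintype.piFinset (fun _ : S₀ ↦ Finset.range 3), (∏ v : S₀, ((A.localPolynomialAt (v : IsDedekindDomain.HeightOneSpectrum (NumberField.RingOfIntegers ℚ))).map (Int.castRingHom (PadicAlgCl 2))).coeff (k v) * ((Rat.HeightOneSpectrum.natGenerator (v : IsDedekindDomain.HeightOneSpectrum (NumberField.RingOfIntegers ℚ)) : PadicAlgCl 2)⁻¹) ^ (k v)) * algebraMap ℚ (PadicAlgCl 2) (ratPlusSymbol fA (r * ((∏ v : S₀, Rat.HeightOneSpectrum.natGenerator (v : IsDedekindDomain.HeightOneSpectrum (NumberField.RingOfIntegers ℚ)) ^ (k v) : ℕ) : ℚ))))‖ < 1 :=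
  depletedParity_of_congruent_of_plusLine_anyRank
    (plusLineAtTwoLevel_of_charTwoLevel (plusLineCharTwo_of_facts hES hF hMK hSD hBz hSe))
    hss hΔ hf hAodd hfA hcong S₀ hS2 hSW hSA ϖ ϖA hμW hμA r

end PlusLine

end Summit.BirchSwinnertonDyer.BirchSwinnertonDyer.Theorems.MazurTateCongruenceAtTwoR

end
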